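import Literature.Probability.RandomPlanarGeometry.UnrootedShiftInvariance
import HarnessLib

/-!
# Time smears of section measures: un-smearing a shift-invariant measure on two-sided paths

Topic `Probability/RandomPlanarGeometry`; support file in the sequence `TwoSidedWholePlaneSLE` →
`TwoSidedWholePlaneSLEStationarity` → `UnrootedShiftInvariance` (Zhan (2021), Cor. 4.7: stationary
increments of the two-sided whole-plane SLE_κ natural parametrisation). Everything here is proved and
nothing is specific to SLE; no named fact is introduced.

`UnrootedShiftInvariance` reduces the corrected Cor. 4.7 to the natural-parametrisation reading of
Zhan's Thm 4.1 (iv) (`μ¹_∞(dγ) ⊗ ℳ_γ(dz) = ν^#_{∞⇌z}(dγ) ⊗ m²(dz)`), namely `lebesgueSmear μ = c •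
timeSmear M` for an s-finite `M` (`isRerootInvariant_of_lebesgueSmear_eq_timeSmear`), and proves that
time smears are shift invariant (`timeSmear_map_timeShiftPath`). This file supplies the converse
mechanism — **a shift-invariant s-finite measure on `C(ℝ, ℂ)` that admits a Borel, a.e.
shift-equivariant time selector IS a time smear**, of an explicit **section measure** — from which the
sequel `TimeSmearPalmDuality` derives `IsRerootInvariant μ ↔ ∃ M, lebesgueSmear μ = timeSmear M` for
rooted laws escaping to `∞` in the past (so that Thm 4.1 (iv) for the root `∞` and the stationarity
half of Cor. 4.7 are two readings of one statement). Two elementary steps ([folklore]; the first is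
the case `G = ℝ` of the product structure of measures on `α × G` invariant under `G` acting on one
factor, cf. Kallenberg, *Foundations of Modern Probability*, 3rd ed. (2021), Thm 2.29, and the
Palm/section calculus of stationary random measures):

* `prod_volume_eq_of_forall_map_add_right` — an s-finite measure `ρ` on `α × ℝ` invariant under the
  translations `(a, t) ↦ (a, t + s)` equals `(ρ|_{α × [0,1]}).map fst ⊗ Leb` (two Tonelli
  computations, `measure_eq_lintegral_inter_window` and `windowMarginal_prod_volume_apply`; no
  σ-finiteness of the marginal is needed since both sides are evaluated on every measurable set);
* `eq_timeSmear_sectionMeasure` — for a shift-invariant s-finite `L` on `C(ℝ, ℂ)` and a Borel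
  selector `τ` with `τ (γ(s + ·)) = τ γ - s` for `L`-a.e. `γ` and all `s`, the map
  `γ ↦ (γ(τ γ + ·), -τ γ)` straightens the shift flow into the translation flow on `C(ℝ, ℂ) × ℝ`
  and inverts the smear `(β, t) ↦ β(t + ·)`, whence `L = timeSmear (sectionMeasure L τ)` with
  `sectionMeasure L τ` the unit-window marginal of the straightened measure (Zhan's `μ¹_∞` read in the
  natural parametrisation based at the selected time, when `L = lebesgueSmear ν̂^#`).

A concrete selector (the first approach time on paths with `‖γ t‖ → ∞` as `t → -∞`) and the duality
statements are in `TimeSmearPalmDuality`.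

## References

* D. Zhan, *SLE loop measures*, PTRF 179 (2021), arXiv:1702.08026 (arXiv numbering): Thm 4.1
  (iii)–(iv), Cor. 4.7 and its proof (the un-rooting maps `𝒯_*`, `ℛ_Γ`). [Zhan2021SLELoopMeasures]
* O. Kallenberg, *Foundations of Modern Probability*, 3rd ed., Springer (2021), Thm 2.29.
-/

noncomputable section

open Set Filter Topology MeasureTheory
open scoped NNReal ENNReal

namespace Literature.Probability.RandomPlanarGeometry

open scoped PathBorel

/-! ### Measures on `α × ℝ` invariant under translation of the real coordinate -/

section Factorization

variable {α : Type*} [MeasurableSpace α]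

/-- **Window decomposition** of an s-finite measure `ρ` on `α × ℝ`: `ρ E = ∫ ρ(E ∩ α × [u, u+1]) du`
(Tonelli: every level `t` lies in the windows `[u, u + 1]`, `u ∈ [t - 1, t]`, of total length `1`). [folklore] -/
theorem measure_eq_lintegral_inter_window (ρ : Measure (α × ℝ)) [SFinite ρ] {E : Set (α × ℝ)}
    (hE : MeasurableSet E) :
    ρ E = ∫⁻ u : ℝ, ρ (E ∩ univ ×ˢ Icc u (u + 1)) := by
  have hmeas : Measurable fun x : ℝ × (α × ℝ) ↦
      E.indicator (1 : α × ℝ → ℝ≥0∞) x.2 * (Icc (x.2.2 - 1) x.2.2).indicator (1 : ℝ → ℝ≥0∞) x.1 := by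
    refine ((measurable_const.indicator hE).comp measurable_snd).mul ?_
    have hset : MeasurableSet {x : ℝ × (α × ℝ) | x.2.2 - 1 ≤ x.1 ∧ x.1 ≤ x.2.2} :=
      (measurableSet_le ((measurable_snd.comp measurable_snd).sub_const 1) measurable_fst).inter
        (measurableSet_le measurable_fst (measurable_snd.comp measurable_snd))
    have : (fun x : ℝ × (α × ℝ) ↦ (Icc (x.2.2 - 1) x.2.2).indicator (1 : ℝ → ℝ≥0∞) x.1) =
        {x : ℝ × (α × ℝ) | x.2.2 - 1 ≤ x.1 ∧ x.1 ≤ x.2.2}.indicator 1 := by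
      funext x
      simp only [indicator, mem_Icc, mem_setOf_eq, Pi.one_apply]
    rw [this]
    exact measurable_const.indicator hset
  have hpt : ∀ (u : ℝ) (q : α × ℝ), (E ∩ univ ×ˢ Icc u (u + 1)).indicator (1 : α × ℝ → ℝ≥0∞) q =
      E.indicator (1 : α × ℝ → ℝ≥0∞) q * (Icc (q.2 - 1) q.2).indicator (1 : ℝ → ℝ≥0∞) u := by
    intro u q
    by_cases hq : q ∈ E
    · by_cases hu : u ∈ Icc (q.2 - 1) q.2
      · have : q ∈ E ∩ univ ×ˢ Icc u (u + 1) :=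
          ⟨hq, mem_univ _, by linarith [hu.2], by linarith [hu.1]⟩
        simp [this, hq, hu]
      · have : q ∉ E ∩ univ ×ˢ Icc u (u + 1) := by
          rintro ⟨-, -, h1, h2⟩
          exact hu ⟨by linarith, by linarith⟩
        simp [this, hu]
    · have : q ∉ E ∩ univ ×ˢ Icc u (u + 1) := fun h ↦ hq h.1
      simp [this, hq]
  calc ρ E = ∫⁻ q, E.indicator 1 q ∂ρ := (lintegral_indicator_one hE).symm
    _ = ∫⁻ q, E.indicator (1 : α × ℝ → ℝ≥0∞) q * volume (Icc (q.2 - 1) q.2) ∂ρ := by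
        refine lintegral_congr fun q ↦ ?_
        rw [Real.volume_Icc, show q.2 - (q.2 - 1) = 1 by ring, ENNReal.ofReal_one, mul_one]
    _ = ∫⁻ q, ∫⁻ u, E.indicator (1 : α × ℝ → ℝ≥0∞) q *
          (Icc (q.2 - 1) q.2).indicator (1 : ℝ → ℝ≥0∞) u ∂volume ∂ρ := by
        refine lintegral_congr fun q ↦ ?_
        have h1 : Measurable ((Icc (q.2 - 1) q.2).indicator (1 : ℝ → ℝ≥0∞)) :=
          measurable_one.indicator measurableSet_Icc
        rw [lintegral_const_mul _ h1, lintegral_indicator_one measurableSet_Icc]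
    _ = ∫⁻ u, ∫⁻ q, E.indicator (1 : α × ℝ → ℝ≥0∞) q *
          (Icc (q.2 - 1) q.2).indicator (1 : ℝ → ℝ≥0∞) u ∂ρ ∂volume :=
        (lintegral_lintegral_swap hmeas.aemeasurable).symm
    _ = ∫⁻ u, ρ (E ∩ univ ×ˢ Icc u (u + 1)) := by
        refine lintegral_congr fun u ↦ ?_
        rw [← lintegral_indicator_one (hE.inter (MeasurableSet.univ.prod measurableSet_Icc))]
        exact lintegral_congr fun q ↦ (hpt u q).symm

/-- **The unit-window marginal times Lebesgue measure, on windows**: if `ρ` is invariant under the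
translations `(a, t) ↦ (a, t + s)`, then `((ρ|_{α × [0,1]}).map fst ⊗ Leb) E = ∫ ρ(E ∩ α × [u, u+1]) du`
(translation invariance of Lebesgue measure in the fibre, Tonelli, and invariance of `ρ` to move the
window `[0, 1]` to `[u, u + 1]`). [folklore] -/
theorem windowMarginal_prod_volume_apply (ρ : Measure (α × ℝ)) [SFinite ρ]
    (hρ : ∀ s : ℝ, ρ.map (fun p : α × ℝ ↦ (p.1, p.2 + s)) = ρ) {E : Set (α × ℝ)}
    (hE : MeasurableSet E) :
    (((ρ.restrict (univ ×ˢ Icc (0 : ℝ) 1)).map Prod.fst).prod (volume : Measure ℝ)) E =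
      ∫⁻ u : ℝ, ρ (E ∩ univ ×ˢ Icc u (u + 1)) := by
  set W : Set (α × ℝ) := univ ×ˢ Icc (0 : ℝ) 1 with hWdef
  have hW : MeasurableSet W := MeasurableSet.univ.prod measurableSet_Icc
  have hT : ∀ s : ℝ, Measurable fun p : α × ℝ ↦ (p.1, p.2 + s) :=
    fun s ↦ measurable_fst.prodMk (measurable_snd.add_const s)
  have hind : ∀ (a : α) (t : ℝ), (Prod.mk a ⁻¹' E).indicator (1 : ℝ → ℝ≥0∞) t =
      E.indicator (1 : α × ℝ → ℝ≥0∞) (a, t) := by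
    intro a t
    by_cases h : (a, t) ∈ E <;> simp [h]
  have hA : ∀ p : α × ℝ, volume (Prod.mk p.1 ⁻¹' E) =
      ∫⁻ u, E.indicator (1 : α × ℝ → ℝ≥0∞) (p.1, p.2 + u) := by
    intro p
    rw [← lintegral_indicator_one (measurable_prodMk_left hE),
      ← lintegral_add_left_eq_self _ p.2]
    exact lintegral_congr fun u ↦ hind p.1 (p.2 + u)
  have hmeas : Measurable fun x : (α × ℝ) × ℝ ↦
      W.indicator (1 : α × ℝ → ℝ≥0∞) x.1 * E.indicator (1 : α × ℝ → ℝ≥0∞) (x.1.1, x.1.2 + x.2) :=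
    ((measurable_one.indicator hW).comp measurable_fst).mul
      ((measurable_one.indicator hE).comp ((measurable_fst.comp measurable_fst).prodMk
        ((measurable_snd.comp measurable_fst).add measurable_snd)))
  have hpt : ∀ (u : ℝ) (p : α × ℝ),
      W.indicator (1 : α × ℝ → ℝ≥0∞) p * E.indicator (1 : α × ℝ → ℝ≥0∞) (p.1, p.2 + u) =
        (E ∩ univ ×ˢ Icc u (u + 1)).indicator (1 : α × ℝ → ℝ≥0∞) (p.1, p.2 + u) := by
    intro u p
    have hiff : p ∈ W ↔ (p.1, p.2 + u) ∈ (univ : Set α) ×ˢ Icc u (u + 1) := by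
      simp only [hWdef, mem_prod, mem_univ, true_and, mem_Icc]
      constructor <;> rintro ⟨h1, h2⟩ <;> constructor <;> linarith
    by_cases hp : p ∈ W
    · have hp' := hiff.1 hp
      by_cases hq : (p.1, p.2 + u) ∈ E
      · simp [hp, hq, hp']
      · simp [hp, hq]
    · have hp' : (p.1, p.2 + u) ∉ (univ : Set α) ×ˢ Icc u (u + 1) := fun h ↦ hp (hiff.2 h)
      simp [hp, hp']
  rw [Measure.prod_apply hE, lintegral_map (measurable_measure_prodMk_left hE) measurable_fst]
  calc ∫⁻ p, volume (Prod.mk p.1 ⁻¹' E) ∂(ρ.restrict W)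
      = ∫⁻ p in W, ∫⁻ u, E.indicator (1 : α × ℝ → ℝ≥0∞) (p.1, p.2 + u) ∂volume ∂ρ :=
        lintegral_congr fun p ↦ hA p
    _ = ∫⁻ p, ∫⁻ u, W.indicator (1 : α × ℝ → ℝ≥0∞) p *
          E.indicator (1 : α × ℝ → ℝ≥0∞) (p.1, p.2 + u) ∂volume ∂ρ := by
        rw [← lintegral_indicator hW]
        refine lintegral_congr fun p ↦ ?_
        by_cases hp : p ∈ W
        · simp [hp]
        · simp [hp]
    _ = ∫⁻ u, ∫⁻ p, W.indicator (1 : α × ℝ → ℝ≥0∞) p *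
          E.indicator (1 : α × ℝ → ℝ≥0∞) (p.1, p.2 + u) ∂ρ ∂volume :=
        lintegral_lintegral_swap hmeas.aemeasurable
    _ = ∫⁻ u, ρ (E ∩ univ ×ˢ Icc u (u + 1)) := by
        refine lintegral_congr fun u ↦ ?_
        have hEu : MeasurableSet (E ∩ univ ×ˢ Icc u (u + 1)) :=
          hE.inter (MeasurableSet.univ.prod measurableSet_Icc)
        calc ∫⁻ p, W.indicator (1 : α × ℝ → ℝ≥0∞) p *
              E.indicator (1 : α × ℝ → ℝ≥0∞) (p.1, p.2 + u) ∂ρ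
            = ∫⁻ p, (E ∩ univ ×ˢ Icc u (u + 1)).indicator (1 : α × ℝ → ℝ≥0∞)
                ((fun p : α × ℝ ↦ (p.1, p.2 + u)) p) ∂ρ := lintegral_congr (hpt u)
          _ = ∫⁻ q, (E ∩ univ ×ˢ Icc u (u + 1)).indicator (1 : α × ℝ → ℝ≥0∞) q
                ∂(ρ.map fun p : α × ℝ ↦ (p.1, p.2 + u)) :=
              (lintegral_map (measurable_one.indicator hEu) (hT u)).symm
          _ = ρ (E ∩ univ ×ˢ Icc u (u + 1)) := by rw [hρ u, lintegral_indicator_one hEu]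

/-- **Factorisation of translation-invariant measures** (the case `G = ℝ` of the product structure of
measures on `α × G` invariant under `G` acting on the second factor): an s-finite measure on `α × ℝ`
invariant under every translation `(a, t) ↦ (a, t + s)` is the product of its unit-window marginal
with Lebesgue measure. No σ-finiteness of the marginal is needed: both sides are computed on every
measurable set by the two window formulas above. [folklore] -/
theorem prod_volume_eq_of_forall_map_add_right (ρ : Measure (α × ℝ)) [SFinite ρ]
    (hρ : ∀ s : ℝ, ρ.map (fun p : α × ℝ ↦ (p.1, p.2 + s)) = ρ) :
    ((ρ.restrict (univ ×ˢ Icc (0 : ℝ) 1)).map Prod.fst).prod (volume : Measure ℝ) = ρ := by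
  ext E hE
  rw [windowMarginal_prod_volume_apply ρ hρ hE, ← measure_eq_lintegral_inter_window ρ hE]

end Factorization

/-! ### Un-smearing along a time selector -/

section Section

/-- Shifting back undoes a time shift: `timeShiftPath (-s) (timeShiftPath s γ) = γ`. [folklore] -/
theorem timeShiftPath_neg_timeShiftPath (s : ℝ) (γ : C(ℝ, ℂ)) :
    timeShiftPath (-s) (timeShiftPath s γ) = γ := by
  rw [timeShiftPath_timeShiftPath, add_neg_cancel, timeShiftPath_zero]

/-- **Straightening map** of a time selector `τ`: `γ ↦ (γ(τ γ + ·), -τ γ)`, the path re-based at its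
selected time together with (minus) that time. It is a right inverse of the smear
`(β, t) ↦ β(t + ·)` and, where `τ` is shift-equivariant, conjugates the shift `γ ↦ γ(s + ·)` to the
translation `(β, t) ↦ (β, t + s)`. [folklore] -/
def straighten (τ : C(ℝ, ℂ) → ℝ) (γ : C(ℝ, ℂ)) : C(ℝ, ℂ) × ℝ :=
  (timeShiftPath (τ γ) γ, -τ γ)

/-- Components of the straightening map. [folklore] -/
@[simp] theorem straighten_apply (τ : C(ℝ, ℂ) → ℝ) (γ : C(ℝ, ℂ)) :
    straighten τ γ = (timeShiftPath (τ γ) γ, -τ γ) := rfl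

/-- The straightening map of a Borel selector is Borel. [folklore] -/
theorem measurable_straighten {τ : C(ℝ, ℂ) → ℝ} (hτ : Measurable τ) : Measurable (straighten τ) :=
  (measurable_timeShiftPath₂.comp (measurable_id.prodMk hτ)).prodMk hτ.neg

/-- Smearing after straightening is the identity: `(γ(τ γ + ·))((-τ γ) + ·) = γ`. [folklore] -/
theorem timeShiftPath_straighten (τ : C(ℝ, ℂ) → ℝ) (γ : C(ℝ, ℂ)) :
    timeShiftPath (straighten τ γ).2 (straighten τ γ).1 = γ :=
  timeShiftPath_neg_timeShiftPath (τ γ) γ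

/-- **The section measure** of a measure `L` on two-sided paths along the time selector `τ`: the
unit-window marginal `((L.map (straighten τ))|_{C(ℝ,ℂ) × [0,1]}).map fst` of the straightened measure —
the mass of paths whose selected time falls in a unit window, re-based at that time. For
`L = lebesgueSmear ν̂^#` (two-sided whole-plane SLE_κ re-based at a Lebesgue point) this is Zhan's rooted
loop measure `μ¹_∞` read in the natural parametrisation based at the selected time (Zhan (2021),
Thm 4.1 (iv); there `μ¹_∞ ⊗ ℳ_γ`, here `timeSmear`). It is s-finite when `L` is. [folklore] -/
def sectionMeasure (L : Measure C(ℝ, ℂ)) (τ : C(ℝ, ℂ) → ℝ) : Measure C(ℝ, ℂ) :=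
  ((L.map (straighten τ)).restrict (univ ×ˢ Icc (0 : ℝ) 1)).map Prod.fst

/-- The section measure of an s-finite measure is s-finite. [folklore] -/
instance sFinite_sectionMeasure (L : Measure C(ℝ, ℂ)) [SFinite L] (τ : C(ℝ, ℂ) → ℝ) :
    SFinite (sectionMeasure L τ) := by
  unfold sectionMeasure; infer_instance

/-- **Straightening conjugates shifts to translations**: if `τ` is Borel and `L`-a.e.
shift-equivariant, the straightened measure `L.map (straighten τ)` of a shift-invariant `L` is
invariant under `(β, t) ↦ (β, t + s)`. [folklore] -/
theorem map_straighten_map_add_right (L : Measure C(ℝ, ℂ)) (hinv : ∀ s, L.map (timeShiftPath s) = L)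
    {τ : C(ℝ, ℂ) → ℝ} (hτ : Measurable τ) (heq : ∀ᵐ γ ∂L, ∀ s, τ (timeShiftPath s γ) = τ γ - s)
    (s : ℝ) :
    (L.map (straighten τ)).map (fun p : C(ℝ, ℂ) × ℝ ↦ (p.1, p.2 + s)) = L.map (straighten τ) := by
  have hT : Measurable fun p : C(ℝ, ℂ) × ℝ ↦ (p.1, p.2 + s) :=
    measurable_fst.prodMk (measurable_snd.add_const s)
  rw [Measure.map_map hT (measurable_straighten hτ)]
  have hae : ((fun p : C(ℝ, ℂ) × ℝ ↦ (p.1, p.2 + s)) ∘ straighten τ) =ᵐ[L]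
      (straighten τ ∘ timeShiftPath s) := by
    filter_upwards [heq] with γ hγ
    simp only [Function.comp_apply, straighten_apply, hγ s, timeShiftPath_timeShiftPath, neg_sub]
    refine Prod.ext ?_ ?_
    · simp only [add_sub_cancel]
    · simp only; ring
  rw [Measure.map_congr hae, ← Measure.map_map (measurable_straighten hτ) (measurable_timeShiftPath s),
    hinv s]

/-- **Un-smearing theorem**: a shift-invariant s-finite measure `L` on two-sided paths with a Borel,
`L`-a.e. shift-equivariant time selector `τ` is the time smear of its section measure,
`L = timeSmear (sectionMeasure L τ)` — the straightened measure is translation invariant, hence the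
product of the section measure with Lebesgue measure (`prod_volume_eq_of_forall_map_add_right`), and
smearing that product gives back `L` (`timeShiftPath_straighten`). With `timeSmear_map_timeShiftPath`
this characterises time smears among s-finite measures carried by paths admitting such a selector.
[folklore] -/
theorem eq_timeSmear_sectionMeasure (L : Measure C(ℝ, ℂ)) [SFinite L]
    (hinv : ∀ s, L.map (timeShiftPath s) = L) {τ : C(ℝ, ℂ) → ℝ} (hτ : Measurable τ)
    (heq : ∀ᵐ γ ∂L, ∀ s, τ (timeShiftPath s γ) = τ γ - s) :
    L = timeSmear (sectionMeasure L τ) := by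
  have hfact := prod_volume_eq_of_forall_map_add_right (L.map (straighten τ))
    (map_straighten_map_add_right L hinv hτ heq)
  have hsmear : (fun p : C(ℝ, ℂ) × ℝ ↦ timeShiftPath p.2 p.1) ∘ straighten τ = id :=
    funext (timeShiftPath_straighten τ)
  calc L = L.map id := Measure.map_id.symm
    _ = (L.map (straighten τ)).map (fun p : C(ℝ, ℂ) × ℝ ↦ timeShiftPath p.2 p.1) := by
        rw [← hsmear, Measure.map_map measurable_timeShiftPath₂ (measurable_straighten hτ)]
    _ = timeSmear (sectionMeasure L τ) := by rw [timeSmear, sectionMeasure, hfact]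

/-- Existential form: such an `L` is the time smear of some s-finite measure. [folklore] -/
theorem exists_eq_timeSmear_of_forall_map_timeShiftPath (L : Measure C(ℝ, ℂ)) [SFinite L]
    (hinv : ∀ s, L.map (timeShiftPath s) = L) {τ : C(ℝ, ℂ) → ℝ} (hτ : Measurable τ)
    (heq : ∀ᵐ γ ∂L, ∀ s, τ (timeShiftPath s γ) = τ γ - s) :
    ∃ M : Measure C(ℝ, ℂ), SFinite M ∧ L = timeSmear M :=
  ⟨sectionMeasure L τ, inferInstance, eq_timeSmear_sectionMeasure L hinv hτ heq⟩

end Section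

end Literature.Probability.RandomPlanarGeometry
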